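import Mathlib.Algebra.Group.Subgroup.Basic
import Mathlib.GroupTheory.OrderOfElement
import Mathlib.Tactic.Abel
import Mathlib.Tactic.IntervalCases
import HarnessLib

/-!
# The additive core of the descent along the congruence filtration of a central extension of `SL₂(ℤ/p^e)`

Let `1 → Z → E → SL₂(ℤ/p^e) → 1` (`e ≥ 2`, `p ≥ 5`, `Z` central of exponent `p`) and let `A ⊆ E` be the preimage
of the top layer `1 + ϖ·𝔰𝔩₂(𝔽_p)` (`ϖ = p^{e-1}`, file `SL2PrimePowTopLayer`).  Once `A` is known to be abelian, all
remaining bookkeeping of the descent is LINEAR ALGEBRA in the additive group `V = A` with the conjugation operators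
`φt, φl, φs, φd` of `T̄, L̄, S̄ = T̄⁻¹L̄T̄⁻¹, D̄ = diag(2, 2⁻¹)` and the vectors `e, h, f` (classes of `T̄^{p^{e-1}}`,
of `T̄ f T̄⁻¹ f⁻¹ e`, of `L̄^{p^{e-1}}`).  This file proves that bookkeeping ABSTRACTLY, for any additive commutative
group `V`, automorphisms `φ•` and subgroup `Z` of fixed `p`-torsion vectors:

* `torsion` — `p•e = p•h = p•f = 0` (no invariant functional on `𝔰𝔩₂(𝔽_p)`, `p` odd);
* `t_h` — the constant `z' ∈ Z` in `φt h = h - 2e + z'` vanishes, using the TORUS (`φd e = 4e`, `φd f = bf`,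
  `4b ≡ 1`, `φd φt = φt⁴ φd` give `3z' = 0`) — the elementary replacement for the cohomological input
  `H¹(SL₂(𝔽_p), M) = 0` / the weights of [CalegariDimitrovTang2025, §4.5, (4.5.8)], valid uniformly for `p ≥ 5`
  (including `p = 5`, where `H¹ ≠ 0` but the specific class still dies because `e` is `φt`-fixed);
* `l_e`, `l_h` — `φl e = e - h - f` and the constant in `φl h` vanishes, from `φs e = -f`, `φs f = -e`;
* `t_symm`, `l_symm` — inverse formulas, used for the normality of the complement `⟨e, h, f⟩`.

Consequence (sequel file): `⟨e, h, f⟩` is an `E`-normal complement of `Z` in `A`, and `E/⟨e,h,f⟩` is again a central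
exponent-`p` extension, of `SL₂(ℤ/p^{e-1})`: the `p`-part of the Schur multiplier of `SL₂(ℤ/p^e)` vanishes for
`p ≥ 5` [Beyl1986].  No group `E` appears in this file; proofs are `abel` computations.
-/

namespace Literature.GroupTheory.ArithmeticGroups

namespace SL2DescentLinear

variable {V : Type*} [AddCommGroup V]

/-- Iteration of the unipotent operator: if `φ e = e`, `φ h = h - 2e + z`, `φ z = z`, `φ f = h - e + f` then `φ⁴
f = f + 4h - 16e + 6z` (the action of `T̄⁴` on the layer `1 + ϖ·𝔰𝔩₂` of a central extension). [cite:
CalegariDimitrovTang2025, §4.5, Lemma 4.5.6 and (4.5.8)] -/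
theorem iterate_four_f (φ : V ≃+ V) (e h f z : V) (he : φ e = e) (hh : φ h = h - 2 • e + z)
    (hz : φ z = z) (hf : φ f = h - e + f) :
    φ (φ (φ (φ f))) = f + 4 • h - 16 • e + 6 • z := by
  simp only [hf, he, hh, hz, map_add, map_sub, map_nsmul]
  abel

/-- Iteration: `φ⁴ h = h - 8e + 4z` under the same relations. [cite: CalegariDimitrovTang2025, §4.5, Lemma 4.5.6
and (4.5.8)] -/
theorem iterate_four_h (φ : V ≃+ V) (e h z : V) (he : φ e = e) (hh : φ h = h - 2 • e + z)
    (hz : φ z = z) :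
    φ (φ (φ (φ h))) = h - 8 • e + 4 • z := by
  simp only [he, hh, hz, map_add, map_sub, map_nsmul]
  abel

/-- An element killed by two coprime natural numbers is zero. [folklore] -/
private theorem eq_zero_of_nsmul_eq_zero_of_coprime {a b : ℕ} (hab : a.Coprime b) {x : V} (ha : a • x = 0)
    (hb : b • x = 0) : x = 0 := by
  have h1 : addOrderOf x ∣ a := addOrderOf_dvd_of_nsmul_eq_zero ha
  have h2 : addOrderOf x ∣ b := addOrderOf_dvd_of_nsmul_eq_zero hb
  have : addOrderOf x ∣ 1 := by rw [← hab]; exact Nat.dvd_gcd h1 h2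
  rwa [Nat.dvd_one, AddMonoid.addOrderOf_eq_one_iff] at this


/-- `Ad(L) e = e - h - f` in the layer of a central extension, from `L = T S T` and `Ad(S) e = -f`: `φl e = e -
h - f` whenever `φl = φt ∘ φs ∘ φt`, `φt e = e`, `φs e = -f`, `φt f = h - e + f`. [cite:
CalegariDimitrovTang2025, §4.5, Lemma 4.5.6 and (4.5.8)] -/
theorem l_e (φt φl φs : V ≃+ V) (e h f : V) (te : φt e = e) (tf : φt f = h - e + f) (se : φs e = -f)
    (hl : ∀ v, φl v = φt (φs (φt v))) : φl e = e - h - f := by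
  rw [hl, te, se, map_neg, tf]; abel


/-- **The layer of a central extension has exponent `p`** (`p` odd): if the classes `p•e, p•h, p•f` are central
(lie in the fixed, `p`-torsion subgroup `Z`) and the operators act by the `𝔰𝔩₂`-table up to `Z`, then `p•e = p•h
= p•f = 0` — the `p`-power map would be an invariant functional on `𝔰𝔩₂(𝔽_p)`, and there is none. [cite:
CalegariDimitrovTang2025, §4.5, Lemma 4.5.6 and (4.5.8)] -/
theorem torsion {p : ℕ} (hp : p.Prime) (hp2 : p ≠ 2) (φt φl : V ≃+ V) (e h f : V) (Z : AddSubgroup V)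
    (pZ : ∀ z ∈ Z, p • z = 0) (fixt : ∀ z ∈ Z, φt z = z) (fixl : ∀ z ∈ Z, φl z = z)
    (pe : p • e ∈ Z) (ph : p • h ∈ Z) (pf : p • f ∈ Z)
    (tf : φt f = h - e + f) (th : φt h - (h - 2 • e) ∈ Z) (le : φl e = e - h - f) :
    p • e = 0 ∧ p • h = 0 ∧ p • f = 0 := by
  have hcop : Nat.Coprime 2 p := (Nat.coprime_primes Nat.prime_two hp).mpr (Ne.symm hp2)
  set z' := φt h - (h - 2 • e) with hz'
  have hth : φt h = h - 2 • e + z' := by rw [hz']; abel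
  have h1 : p • φt h = p • h := by rw [← map_nsmul, fixt _ ph]
  rw [hth, smul_add, smul_sub, pZ _ th, add_zero, smul_comm] at h1
  have h2e : 2 • (p • e) = 0 := sub_eq_self.mp h1
  have hpe : p • e = 0 := eq_zero_of_nsmul_eq_zero_of_coprime hcop h2e (pZ _ pe)
  have h2 : p • φt f = p • f := by rw [← map_nsmul, fixt _ pf]
  rw [tf, smul_add, smul_sub, hpe, sub_zero, add_eq_right] at h2
  have h3 : p • φl e = p • e := by rw [← map_nsmul, fixl _ pe]
  rw [le, smul_sub, smul_sub, hpe, h2] at h3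
  simp only [sub_self, zero_sub, neg_eq_zero] at h3
  exact ⟨hpe, h2, h3⟩


/-- **The `T̄`-cocycle constant vanishes** (`p ≥ 5`): with the torus operator `φd` (`φd e = 4e`, `φd f = b f`,
`4b ≡ 1 (mod p)`, `φd φt = φt⁴ φd`) the constant `z'` in `φt h = h - 2e + z'` satisfies `3 z' = 0`, hence `z' =
0`.  This is the elementary substitute for `H¹(SL₂(𝔽_p), M) = 0` / the weight argument of the cited proof.
[cite: CalegariDimitrovTang2025, §4.5, Lemma 4.5.6 and (4.5.8)] -/
theorem t_h {p : ℕ} (hp : p.Prime) (hp3 : p ≠ 3) (φt φd : V ≃+ V) (e h f z' : V) (Z : AddSubgroup V)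
    (pZ : ∀ z ∈ Z, p • z = 0) (fixt : ∀ z ∈ Z, φt z = z) (fixd : ∀ z ∈ Z, φd z = z) (hz' : z' ∈ Z)
    (pe : p • e = 0) (ph : p • h = 0)
    (te : φt e = e) (tf : φt f = h - e + f) (th : φt h = h - 2 • e + z')
    (de : φd e = 4 • e) {b k : ℕ} (df : φd f = b • f) (hb : 4 * b = k * p + 1)
    (dt : ∀ v, φd (φt v) = φt (φt (φt (φt (φd v))))) :
    φt h = h - 2 • e := by
  have hz't : φt z' = z' := fixt _ hz'
  have hh : h = φt f - f + e := by rw [tf]; abel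
  have hbp : ∀ v : V, p • v = 0 → (4 * b) • v = v := fun v hv ↦ by
    rw [hb, add_nsmul, mul_nsmul', hv, nsmul_zero, zero_add, one_nsmul]
  have φ4f := iterate_four_f φt e h f z' te th hz't tf
  have φ4h := iterate_four_h φt e h z' te th hz't
  have hbh : 4 • (b • h) = h := by rw [← mul_nsmul', hbp h ph]
  have hbe : 16 • (b • e) = 4 • e := by
    rw [show (16 : ℕ) = 4 * 4 from rfl, mul_nsmul', ← mul_nsmul' e 4 b, hbp e pe]
  have hdh : φd h = h + 6 • (b • z') := by
    conv_lhs => rw [hh]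
    rw [map_add, map_sub, dt f, df, map_nsmul, map_nsmul, map_nsmul, map_nsmul, φ4f, de,
      smul_add, smul_sub, smul_add, smul_comm b 4 h, smul_comm b 16 e, smul_comm b 6 z', hbe, hbh]
    abel
  have key := dt h
  rw [th, map_add, map_sub, map_nsmul, hdh, de, fixd _ hz', map_add, map_add, map_add, map_add,
    φ4h] at key
  simp only [map_nsmul, hz't] at key
  -- key : h + 6 • b • z' - 2 • 4 • e + z' = h - 8 • e + 4 • z' + 6 • b • z'
  have h3 : 3 • z' = 0 := by
    rw [← sub_eq_zero] at key
    have : h + 6 • (b • z') - 2 • 4 • e + z' - (h - 8 • e + 4 • z' + 6 • (b • z')) = -(3 • z') := by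
      abel
    rw [this, neg_eq_zero] at key
    exact key
  have hcop : Nat.Coprime 3 p := (Nat.coprime_primes Nat.prime_three hp).mpr (Ne.symm hp3)
  have hz0 : z' = 0 := eq_zero_of_nsmul_eq_zero_of_coprime hcop h3 (pZ _ hz')
  rw [th, hz0, add_zero]


/-- **The `L̄`-cocycle constant vanishes**: with `φs = φt⁻¹ φl φt⁻¹` and `φs f = -e` (exact, from `S̄ L̄ S̄⁻¹ =
T̄⁻¹` and `ζ^{p^{e-1}} = 1`), the constant `z''` in `φl h = h + 2f + z''` is `0`. [cite:
CalegariDimitrovTang2025, §4.5, Lemma 4.5.6 and (4.5.8)] -/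
theorem l_h (φt φl φs : V ≃+ V) (e h f z'' : V) (te : φt e = e) (tf : φt f = h - e + f)
    (th : φt h = h - 2 • e) (lf : φl f = f) (le : φl e = e - h - f) (lh : φl h = h + 2 • f + z'')
    (sf : φs f = -e) (hs : ∀ v, φs v = φt.symm (φl (φt.symm v))) : φl h = h + 2 • f := by
  have tinv_f : φt.symm f = f - h - e := by
    apply φt.injective
    rw [AddEquiv.apply_symm_apply, map_sub, map_sub, tf, th, te]; abel
  have k1 : φl (φt.symm f) = -e - z'' := by
    rw [tinv_f, map_sub, map_sub, lf, lh, le]; abel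
  have key := hs f
  rw [sf, k1] at key
  have key2 := congr_arg φt key
  rw [AddEquiv.apply_symm_apply, map_neg, te] at key2
  have hz : z'' = 0 := by
    have : (-e - z'') - (-e) = -z'' := by abel
    rw [← key2, sub_self] at this
    exact neg_eq_zero.mp this.symm
  rw [lh, hz, add_zero]


/-- Inverse formulas: `φt⁻¹ e = e`, `φt⁻¹ h = h + 2e`, `φt⁻¹ f = f - h - e`. [cite: CalegariDimitrovTang2025,
§4.5, Lemma 4.5.6 and (4.5.8)] -/
theorem t_symm (φt : V ≃+ V) (e h f : V) (te : φt e = e) (tf : φt f = h - e + f) (th : φt h = h - 2 • e) :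
    φt.symm e = e ∧ φt.symm h = h + 2 • e ∧ φt.symm f = f - h - e := by
  refine ⟨?_, ?_, ?_⟩ <;> apply φt.injective <;> rw [AddEquiv.apply_symm_apply]
  · rw [te]
  · rw [map_add, map_nsmul, th, te]; abel
  · rw [map_sub, map_sub, tf, th, te]; abel


/-- Inverse formulas: `φl⁻¹ f = f`, `φl⁻¹ h = h - 2f`, `φl⁻¹ e = e + h - f`. [cite: CalegariDimitrovTang2025,
§4.5, Lemma 4.5.6 and (4.5.8)] -/
theorem l_symm (φl : V ≃+ V) (e h f : V) (lf : φl f = f) (le : φl e = e - h - f) (lh : φl h = h + 2 • f) :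
    φl.symm f = f ∧ φl.symm h = h - 2 • f ∧ φl.symm e = e + h - f := by
  refine ⟨?_, ?_, ?_⟩ <;> apply φl.injective <;> rw [AddEquiv.apply_symm_apply]
  · rw [lf]
  · rw [map_sub, map_nsmul, lh, lf]; abel
  · rw [map_sub, map_add, le, lh, lf]; abel

end SL2DescentLinear

end Literature.GroupTheory.ArithmeticGroups
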